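import Mathlib
import Summits.NavierStokesRegularity.NavierStokesRegularity.Theorems.FilamentSkeletonRssAnalyticStripLiaSymbolDefs
import Summits.NavierStokesRegularity.NavierStokesRegularity.Theorems.FilamentSkeletonRssAnalyticStripLiaSymbolRep
import Summits.NavierStokesRegularity.NavierStokesRegularity.Theorems.FilamentSkeletonRssAnalyticStripLiaSymbolExpInt

/-!
# Stub P3 `stub_liaSymbol` (line `child_tangent_analytic_strip`, child 28295 of `SkeletonJ1G`) — PART (c):
# the Klein–Majda small-`x` asymptotics of the exact self-induction symbol with an explicit remainder,
# `|𝔖(x) − x²((log(x/2)+γ)/2 + 1/4)| ≤ x⁴(|log x| + 1)` on `(0, ½]`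

Lane ns-filament-19175-p1 g12 (prover), 2026-08-28, `--supports stmt-NavierStokesRegularity-28295 --as helper`.

With `p = x²/4`: `𝔖(x) = ∫₀^∞ e^{−t}(1 − (1+2p/t)e^{−p/t}) dt` (`…LiaSymbolRep`) `= (1 − C(p)) − 2p·E(p)`, and
`1 − C(p) = ∫₀^p E(q) dq` (§1, Fubini for `(q,t) ↦ e^{−t}e^{−q/t}/t` on `(0,p] × (0,∞)`), so the two-sided expansion of
`E` (`…LiaSymbolExpInt.E_bounds`) gives `𝔖(x) = p log p + p + 2γp + Rem`, `−(9/2)p² − 2p² log(1/p) ≤ Rem ≤ 4p² + p² log(1/p)`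
(§2), whence part (c) of `LiaSymbolBound` (§3) since `x⁴(|log x|+1) = 16p²(|log x|+1)` and `log(1/p) = 2|log x| + 2 log 2`.

HONEST FRAMING: classical real analysis serving a HYPOTHETICAL filament-skeleton line on the NEGATIVE side of a MODEL
route; nothing here bears on Navier–Stokes regularity or blow-up.
-/

set_option linter.dupNamespace false

noncomputable section

namespace Summit.NavierStokesRegularity.NavierStokesRegularity.Theorems.AnalyticStripLiaSymbol

open Real Set MeasureTheory Filter Topology

/-! ## §1  `1 − C(p) = ∫₀^p E(q) dq` -/

/-- The `q`-integral of the Fubini integrand: `∫_{(0,p]} e^{−t}e^{−q/t}/t dq = e^{−t}(1 − e^{−p/t})` for `t > 0`, `p ≥ 0`. -/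
theorem integral_Ioc_exp_exp_neg_div_div {p t : ℝ} (hp : 0 ≤ p) (ht : 0 < t) :
    ∫ q in Ioc (0:ℝ) p, Real.exp (-t) * Real.exp (-(q / t)) / t = Real.exp (-t) * (1 - Real.exp (-(p / t))) := by
  have hderiv : ∀ q ∈ Ioo (0:ℝ) p, HasDerivAt (fun u : ℝ => -(Real.exp (-t) * Real.exp (-(u / t))))
      (Real.exp (-t) * Real.exp (-(q / t)) / t) q := by
    intro q _
    have h1 : HasDerivAt (fun u : ℝ => -(u / t)) (-(1 / t)) q := ((hasDerivAt_id q).div_const t).neg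
    have h2 := (Real.hasDerivAt_exp _).comp q h1
    have h3 := (h2.const_mul (Real.exp (-t))).neg
    refine (h3 : HasDerivAt (fun u : ℝ => -(Real.exp (-t) * Real.exp (-(u / t)))) _ q).congr_deriv ?_
    field_simp
  have hcont : ContinuousOn (fun u : ℝ => -(Real.exp (-t) * Real.exp (-(u / t)))) (Icc 0 p) := by
    fun_prop
  have hint : IntervalIntegrable (fun q : ℝ => Real.exp (-t) * Real.exp (-(q / t)) / t) volume 0 p := by
    apply Continuous.intervalIntegrable; fun_prop
  rw [← intervalIntegral.integral_of_le hp, intervalIntegral.integral_eq_sub_of_hasDerivAt_of_le hp hcont hderiv hint]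
  simp only [zero_div, neg_zero, Real.exp_zero, mul_one]
  ring

/-- Integrability of the Fubini integrand `(q,t) ↦ e^{−t}e^{−q/t}/t` on `(0,p] × (0,∞)`. -/
theorem integrable_fubiniIntegrand {p : ℝ} (hp : 0 ≤ p) :
    Integrable (fun z : ℝ × ℝ => Real.exp (-z.2) * Real.exp (-(z.1 / z.2)) / z.2)
      ((volume.restrict (Ioc (0:ℝ) p)).prod (volume.restrict (Ioi (0:ℝ)))) := by
  have hmeas : AEStronglyMeasurable (fun z : ℝ × ℝ => Real.exp (-z.2) * Real.exp (-(z.1 / z.2)) / z.2)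
      ((volume.restrict (Ioc (0:ℝ) p)).prod (volume.restrict (Ioi (0:ℝ)))) := by
    refine Measurable.aestronglyMeasurable ?_
    exact ((Real.measurable_exp.comp measurable_snd.neg).mul
      (Real.measurable_exp.comp (measurable_fst.div measurable_snd).neg)).div measurable_snd
  rw [integrable_prod_iff' hmeas]
  constructor
  · -- slices in `q` for a.e. `t > 0`: continuous on a finite interval
    rw [ae_restrict_iff' measurableSet_Ioi]
    refine Filter.Eventually.of_forall fun t (ht : 0 < t) => ?_
    have hc : Continuous (fun q : ℝ => Real.exp (-t) * Real.exp (-(q / t)) / t) := by fun_prop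
    exact (hc.integrableOn_Icc (a := 0) (b := p)).mono_set Ioc_subset_Icc_self
  · -- the `t`-function `∫_q ‖·‖ = e^{−t}(1 − e^{−p/t}) ≤ e^{−t}`
    have hnorm : ∀ t ∈ Ioi (0:ℝ), ∫ q in Ioc (0:ℝ) p, ‖Real.exp (-t) * Real.exp (-(q / t)) / t‖
        = Real.exp (-t) * (1 - Real.exp (-(p / t))) := by
      intro t ht
      have ht' : 0 < t := ht
      rw [← integral_Ioc_exp_exp_neg_div_div hp ht']
      refine setIntegral_congr_fun measurableSet_Ioc (fun q hq => ?_)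
      rw [Real.norm_eq_abs, abs_of_nonneg (by positivity)]
    have hcongr : (fun t : ℝ => ∫ q in Ioc (0:ℝ) p, ‖Real.exp (-t) * Real.exp (-(q / t)) / t‖)
        =ᵐ[volume.restrict (Ioi (0:ℝ))] fun t => Real.exp (-t) * (1 - Real.exp (-(p / t))) := by
      rw [Filter.EventuallyEq, ae_restrict_iff' measurableSet_Ioi]
      exact Filter.Eventually.of_forall hnorm
    refine Integrable.congr ?_ hcongr.symm
    refine (integrableOn_exp_neg_Ioi 0).mono' ?_ ?_
    · exact ((Real.measurable_exp.comp measurable_neg).mul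
        (measurable_const.sub (Real.measurable_exp.comp (measurable_const.div measurable_id).neg))).aestronglyMeasurable
    · rw [ae_restrict_iff' measurableSet_Ioi]
      refine Filter.Eventually.of_forall fun t (ht : 0 < t) => ?_
      have h1 : Real.exp (-(p / t)) ≤ 1 := by rw [Real.exp_le_one_iff]; exact neg_nonpos.mpr (div_nonneg hp ht.le)
      have h2 : 0 < Real.exp (-(p / t)) := Real.exp_pos _
      rw [Real.norm_eq_abs, abs_of_nonneg (by nlinarith [Real.exp_pos (-t)])]
      nlinarith [Real.exp_pos (-t)]

/-- **`1 − C(p) = ∫₀^p E(q) dq`**: `∫₀^∞ e^{−t}(1 − e^{−p/t}) dt = ∫_{(0,p]} (∫₀^∞ e^{−t}e^{−q/t}/t dt) dq` for `p ≥ 0`. -/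
theorem integral_one_sub_C_eq_integral_E {p : ℝ} (hp : 0 ≤ p) :
    ∫ t in Ioi (0:ℝ), Real.exp (-t) * (1 - Real.exp (-(p / t)))
      = ∫ q in Ioc (0:ℝ) p, ∫ t in Ioi (0:ℝ), Real.exp (-t) * Real.exp (-(q / t)) / t := by
  have hint : Integrable (Function.uncurry fun q t : ℝ => Real.exp (-t) * Real.exp (-(q / t)) / t)
      ((volume.restrict (Ioc (0:ℝ) p)).prod (volume.restrict (Ioi (0:ℝ)))) := integrable_fubiniIntegrand hp
  rw [integral_integral_swap hint]
  refine setIntegral_congr_fun measurableSet_Ioi (fun t ht => ?_)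
  exact (integral_Ioc_exp_exp_neg_div_div hp ht).symm

/-- `q ↦ E(q)` is integrable on `(0, p]`. -/
theorem integrableOn_E_Ioc {p : ℝ} (hp : 0 ≤ p) :
    IntegrableOn (fun q : ℝ => ∫ t in Ioi (0:ℝ), Real.exp (-t) * Real.exp (-(q / t)) / t) (Ioc 0 p) :=
  (integrable_fubiniIntegrand hp).integral_prod_left


/-! ## §2  `𝔖 = ∫₀^p E − 2p·E(p)` and the elementary integrals over `(0, p]` -/

/-- `e^{−t} e^{−p/t}/t` is integrable on `(0, ∞)` for `p > 0`. -/
theorem integrableOn_E_integrand {p : ℝ} (hp : 0 < p) :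
    IntegrableOn (fun t : ℝ => Real.exp (-t) * Real.exp (-(p / t)) / t) (Ioi 0) := by
  have hV1 := integrableOn_exp_neg_div_div_Ioc hp
  have hA := integrableOn_one_sub_exp_mul_exp_neg_div_Ioc hp.le
  have hU := integrableOn_exp_mul_exp_neg_div_Ioi_one hp.le
  have hV : IntegrableOn (fun t : ℝ => Real.exp (-t) * Real.exp (-(p / t)) / t) (Ioc 0 1) := by
    refine (hV1.sub hA).congr_fun (fun t ht => ?_) measurableSet_Ioc
    simp only [Pi.sub_apply]
    ring
  have := hV.union hU
  rwa [Ioc_union_Ioi_eq_Ioi zero_le_one] at this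

/-- `e^{−t}(1 − e^{−p/t})` is integrable on `(0, ∞)` for `p ≥ 0`. -/
theorem integrableOn_oneSubC_integrand {p : ℝ} (hp : 0 ≤ p) :
    IntegrableOn (fun t : ℝ => Real.exp (-t) * (1 - Real.exp (-(p / t)))) (Ioi 0) := by
  refine (integrableOn_exp_neg_Ioi 0).mono' ?_ ?_
  · exact ((Real.measurable_exp.comp measurable_neg).mul
      (measurable_const.sub (Real.measurable_exp.comp (measurable_const.div measurable_id).neg))).aestronglyMeasurable
  · rw [ae_restrict_iff' measurableSet_Ioi]
    refine Filter.Eventually.of_forall fun t (ht : 0 < t) => ?_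
    have h1 : Real.exp (-(p / t)) ≤ 1 := by rw [Real.exp_le_one_iff]; exact neg_nonpos.mpr (div_nonneg hp ht.le)
    have h2 : 0 < Real.exp (-(p / t)) := Real.exp_pos _
    rw [Real.norm_eq_abs, abs_of_nonneg (by nlinarith [Real.exp_pos (-t)])]
    nlinarith [Real.exp_pos (-t)]

/-- **`𝔖(x) = ∫₀^p E(q) dq − 2p·E(p)`**, `p = x²/4`. -/
theorem liaSym_eq_integral_E_sub (x : ℝ) (hx : x ≠ 0) :
    liaSym x = (∫ q in Ioc (0:ℝ) (x ^ 2 / 4), ∫ t in Ioi (0:ℝ), Real.exp (-t) * Real.exp (-(q / t)) / t)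
      - 2 * (x ^ 2 / 4) * ∫ t in Ioi (0:ℝ), Real.exp (-t) * Real.exp (-(x ^ 2 / 4 / t)) / t := by
  have hp : 0 < x ^ 2 / 4 := by positivity
  unfold liaSym
  rw [liaSym_integral_eq_laplace x, ← integral_one_sub_C_eq_integral_E hp.le, ← integral_const_mul,
    ← integral_sub (integrableOn_oneSubC_integrand hp.le) ((integrableOn_E_integrand hp).const_mul _)]
  refine setIntegral_congr_fun measurableSet_Ioi (fun t ht => ?_)
  have ht : (0:ℝ) < t := ht
  have h1 : Real.exp (-x ^ 2 / (4 * t)) = Real.exp (-(x ^ 2 / 4 / t)) := by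
    congr 1; field_simp
  rw [h1]
  field_simp
  ring

/-- `∫_{(0,p]} (−log q) dq = p − p log p`. -/
theorem integral_Ioc_neg_log {p : ℝ} (hp : 0 ≤ p) : ∫ q in Ioc (0:ℝ) p, -Real.log q = p - p * Real.log p := by
  rw [← intervalIntegral.integral_of_le hp, intervalIntegral.integral_neg, integral_log]
  simp

/-- `∫_{(0,p]} q dq = p²/2`. -/
theorem integral_Ioc_id {p : ℝ} (hp : 0 ≤ p) : ∫ q in Ioc (0:ℝ) p, q = p ^ 2 / 2 := by
  rw [← intervalIntegral.integral_of_le hp, integral_id]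
  ring

/-- `∫_{(0,p]} c dq = p·c`. -/
theorem integral_Ioc_const' {p : ℝ} (hp : 0 ≤ p) (c : ℝ) : ∫ _q in Ioc (0:ℝ) p, c = p * c := by
  rw [setIntegral_const, Real.volume_real_Ioc_of_le hp, smul_eq_mul, sub_zero]

/-! ## §3  Part (c) of `LiaSymbolBound` -/

/-- Two-sided bound for `∫₀^p E(q) dq`, `0 < p ≤ 1`. -/
theorem integral_E_bounds {p : ℝ} (hp : 0 < p) (hp1 : p ≤ 1) :
    (p - p * Real.log p) - 2 * Real.eulerMascheroniConstant * p - p ^ 2 / 2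
        ≤ ∫ q in Ioc (0:ℝ) p, ∫ t in Ioi (0:ℝ), Real.exp (-t) * Real.exp (-(q / t)) / t
      ∧ ∫ q in Ioc (0:ℝ) p, ∫ t in Ioi (0:ℝ), Real.exp (-t) * Real.exp (-(q / t)) / t
        ≤ (1 + p) * (p - p * Real.log p) - 2 * Real.eulerMascheroniConstant * p + p ^ 2 := by
  set γ := Real.eulerMascheroniConstant with hγ
  have hIE := integrableOn_E_Ioc hp.le
  have hlogI : IntegrableOn (fun q : ℝ => Real.log q) (Ioc 0 p) := by
    rw [← intervalIntegrable_iff_integrableOn_Ioc_of_le hp.le]; exact intervalIntegral.intervalIntegrable_log'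
  have hidI : IntegrableOn (fun q : ℝ => q) (Ioc 0 p) :=
    (continuous_id.integrableOn_Icc (a := 0) (b := p)).mono_set Ioc_subset_Icc_self
  have hcI : ∀ c : ℝ, IntegrableOn (fun _ : ℝ => c) (Ioc 0 p) := fun c =>
    integrableOn_const (hs := measure_Ioc_lt_top.ne)
  -- comparison functions (lambda-typed integrability facts, so that `integral_add/sub` rewrite)
  have iA : IntegrableOn (fun q : ℝ => -Real.log q) (Ioc 0 p) := hlogI.neg
  have iB : IntegrableOn (fun q : ℝ => -Real.log q - 2 * γ) (Ioc 0 p) := iA.sub (hcI _)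
  have hlo_int : IntegrableOn (fun q : ℝ => -Real.log q - 2 * γ - q) (Ioc 0 p) := iB.sub hidI
  have i2 : IntegrableOn (fun q : ℝ => 2 * q) (Ioc 0 p) := hidI.const_mul 2
  have iD : IntegrableOn (fun q : ℝ => -Real.log q - 2 * γ + 2 * q) (Ioc 0 p) := iB.add i2
  have iE : IntegrableOn (fun q : ℝ => p * -Real.log q) (Ioc 0 p) := iA.const_mul p
  have hhi_int : IntegrableOn (fun q : ℝ => -Real.log q - 2 * γ + 2 * q + p * (-Real.log q)) (Ioc 0 p) := iD.add iE
  have hlo_val : ∫ q in Ioc (0:ℝ) p, (-Real.log q - 2 * γ - q) = (p - p * Real.log p) - 2 * γ * p - p ^ 2 / 2 := by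
    rw [integral_sub iB hidI, integral_sub iA (hcI _), integral_Ioc_neg_log hp.le,
      integral_Ioc_const' hp.le, integral_Ioc_id hp.le]
    ring
  have h2q : ∫ q in Ioc (0:ℝ) p, 2 * q = 2 * (p ^ 2 / 2) := by
    rw [integral_const_mul, integral_Ioc_id hp.le]
  have hplog : ∫ q in Ioc (0:ℝ) p, p * -Real.log q = p * (p - p * Real.log p) := by
    rw [integral_const_mul, integral_Ioc_neg_log hp.le]
  have hhi_val : ∫ q in Ioc (0:ℝ) p, (-Real.log q - 2 * γ + 2 * q + p * (-Real.log q))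
      = (1 + p) * (p - p * Real.log p) - 2 * γ * p + p ^ 2 := by
    rw [integral_add iD iE, integral_add iB i2, integral_sub iA (hcI _), h2q, hplog,
      integral_Ioc_neg_log hp.le, integral_Ioc_const' hp.le]
    ring
  constructor
  · rw [← hlo_val]
    refine setIntegral_mono_on hlo_int hIE measurableSet_Ioc (fun q hq => ?_)
    have := (E_bounds hq.1 (hq.2.trans hp1)).1
    linarith
  · rw [← hhi_val]
    refine setIntegral_mono_on hIE hhi_int measurableSet_Ioc (fun q hq => ?_)
    have h1 := (E_bounds hq.1 (hq.2.trans hp1)).2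
    have hLq : 0 ≤ -Real.log q := by rw [neg_nonneg]; exact Real.log_nonpos hq.1.le (hq.2.trans hp1)
    have h2 : q * (-Real.log q) ≤ p * (-Real.log q) := mul_le_mul_of_nonneg_right hq.2 hLq
    linarith

/-- **PART (c) of `LiaSymbolBound`**: the Klein–Majda asymptotics with explicit remainder,
`|𝔖(x) − x²((log(x/2)+γ)/2 + 1/4)| ≤ x⁴(|log x| + 1)` for `0 < x ≤ ½`. -/
theorem liaSym_asymp (x : ℝ) (hx : 0 < x) (hx1 : x ≤ 1 / 2) :
    |liaSym x - x ^ 2 * ((Real.log (x / 2) + Real.eulerMascheroniConstant) / 2 + 1 / 4)|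
      ≤ x ^ 4 * (|Real.log x| + 1) := by
  set γ := Real.eulerMascheroniConstant with hγ
  set p := x ^ 2 / 4 with hpdef
  have hp : 0 < p := by positivity
  have hx2 : x ^ 2 ≤ 1 / 4 := by nlinarith
  have hp1 : p ≤ 1 := by rw [hpdef]; linarith
  have hL : 0 ≤ -Real.log p := by rw [neg_nonneg]; exact Real.log_nonpos hp.le hp1
  -- the representation and the bounds
  have hrep := liaSym_eq_integral_E_sub x hx.ne'
  have hIE := integral_E_bounds hp hp1
  have hE := E_bounds hp hp1
  -- `log p = 2 log(x/2)`, `x² = 4p`, `x⁴ = 16 p²`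
  have hlogp : Real.log p = 2 * Real.log (x / 2) := by
    rw [hpdef, show x ^ 2 / 4 = (x / 2) ^ 2 by ring, Real.log_pow]; norm_num
  have hlogx2 : Real.log (x / 2) = Real.log x - Real.log 2 := Real.log_div hx.ne' two_ne_zero
  have hlogx : Real.log x < 0 := Real.log_neg hx (by linarith)
  have habs : |Real.log x| = -Real.log x := abs_of_neg hlogx
  have hlog2 : Real.log 2 ≤ 1 := by
    have := Real.log_two_lt_d9; linarith
  have hx4 : x ^ 4 = 16 * p ^ 2 := by rw [hpdef]; ring
  have hx2' : x ^ 2 = 4 * p := by rw [hpdef]; ring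
  -- everything in terms of `p`, `I := ∫₀^p E`, `E(p)`
  rw [show x ^ 2 / 4 = p from rfl] at hrep
  have h2p : (0:ℝ) ≤ 2 * p := by positivity
  have hEp_hi := mul_le_mul_of_nonneg_left hE.2 h2p
  have hEp_lo := mul_le_mul_of_nonneg_left hE.1 h2p
  have h5 : p ^ 2 * Real.log 2 ≤ p ^ 2 * 1 := mul_le_mul_of_nonneg_left hlog2 (sq_nonneg p)
  have h6 : 0 ≤ p ^ 2 * |Real.log x| := by positivity
  have h7 : 0 ≤ Real.log 2 := Real.log_nonneg (by norm_num)
  have hlogp' : Real.log p = 2 * (Real.log x - Real.log 2) := by rw [hlogp, hlogx2]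
  rw [hrep, hx4, hx2', hlogx2, habs]
  rw [habs] at h6
  rw [abs_le]
  constructor
  · nlinarith [hIE.1, hEp_hi, hlogp', h5, h6, h7, sq_nonneg p, hp.le]
  · nlinarith [hIE.2, hEp_lo, hlogp', h5, h6, h7, sq_nonneg p, hp.le]

end Summit.NavierStokesRegularity.NavierStokesRegularity.Theorems.AnalyticStripLiaSymbol
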